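import Summits.Schanuel.Schanuel.Theorems.ZilberEacBoundedBranchDensity
import Summits.Schanuel.Schanuel.Theorems.RigidCoreTwoLogsBranchRelationFiniteCoprime
import HarnessLib

/-!
# Arbitrary base branches, XCIX: ELIMINATION OF `x₀` BETWEEN `F(x₀, x₁)` AND A THREE-VARIABLE
# `H(x₀, x₁, y₁)`; along a bounded branch `e^{x₁}` satisfies no relation with `(x₀, x₁)`

HONEST FRAMING.  Cell `pub-schanuel` (Zilber's Exponential-Algebraic Closedness, case ladder;
host summit Schanuel), seat 2, gen 33.  File LXVI (`exists_eliminant`) eliminates `x₀` between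
`F(x₀, x₁)` and `H(x₀, y₁)`; file LXVII deduces that along a bounded place `x₀ = s^{-k}`,
`x₁ = Φ(s) → θ` of an irreducible curve of `x₁`-degree `≥ 2` no nonzero relation
`H(x₀, e^{x₁}) = 0` holds.  For the surfaces of Mantova–Masser's case whose equations involve
`y₁` (O90) the same is needed for relations `H(x₀, x₁, e^{x₁}) = 0` with `H ∈ ℂ[x₀][x₁][y₁]`:
**`exists_eliminant₃`** (the resultant in `x₀`; nonzero by specialisation at a good point, the
finiteness of `C ∩ {h = 0}` for `F ∤ h` coming from the tree's `finite_commonZeros_of_isRelPrime`)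
and **`not_eventually_relation₃_exp_boundedBranch`**: if some `y₁`-coefficient of `H` is not
divisible by `F`, then `H(s^{-k}, Φ(s), e^{Φ(s)}) ≢ 0` near `s = 0`.  [folklore]; nothing here is
specific to Schanuel's conjecture (neither used nor implied); Mantova–Masser's question (PLMS 2024
§1 p. 5) and EC(3,2) stay OPEN; EAC ⇏ SC.
-/

noncomputable section

open Filter Topology Set Complex Polynomial
open Literature.NumberTheory.Transcendental Literature.ModelTheory.Zilber
open Literature.ModelTheory.ExponentialFields

set_option linter.dupNamespace false

namespace Summit.Schanuel.Schanuel.Theorems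

section EliminantThree

variable (F : ℂ[X][X])

/-! ## Part A. Finiteness of `C ∩ {h = 0}` in the form needed -/

/-- For `F` irreducible and `F ∤ h`, the `x₁`-coordinates of the common zeros of `F` and `h` form
a finite set. [folklore] -/
theorem finite_snd_commonZeros (hFirr : Irreducible F) {h : ℂ[X][X]} (hh : ¬ F ∣ h) :
    {a : ℂ | ∃ c : ℂ, (F.map (Polynomial.evalRingHom c)).eval a = 0 ∧
      (h.map (Polynomial.evalRingHom c)).eval a = 0}.Finite := by
  classical
  obtain ⟨Φr, hΦr⟩ := exists_rowsEquiv
  have hirrA : Irreducible (Φr.symm F) := by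
    refine (irreducible_rows_iff (Q := F) fun x y => ?_).2 hFirr
    rw [hΦr, RingEquiv.apply_symm_apply]
  have hndvd : ¬ Φr.symm F ∣ Φr.symm h := by
    rintro ⟨c, hc⟩
    apply hh
    refine ⟨Φr c, ?_⟩
    have e := congrArg Φr hc
    rwa [RingEquiv.apply_symm_apply, map_mul, RingEquiv.apply_symm_apply] at e
  have hrel : IsRelPrime (Φr.symm F) (Φr.symm h) := hirrA.isRelPrime_iff_not_dvd.2 hndvd
  have hfin := RigidCore.TwoLogs.finite_commonZeros_of_isRelPrime hirrA.ne_zero hrel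
  refine (hfin.image fun v : Fin 2 → ℂ => v 1).subset ?_
  rintro a ⟨c, hFc, hhc⟩
  refine ⟨![c, a], ⟨?_, ?_⟩, rfl⟩
  · show MvPolynomial.eval ![c, a] (Φr.symm F) = 0
    rw [hΦr, RingEquiv.apply_symm_apply]; exact hFc
  · show MvPolynomial.eval ![c, a] (Φr.symm h) = 0
    rw [hΦr, RingEquiv.apply_symm_apply]; exact hhc

/-! ## Part B. The eliminant of `F(x₀, x₁)` and `H(x₀, x₁, y₁)` with respect to `x₀` -/

/-- **Elimination of `x₀`.**  `F` irreducible of `x₁`-degree `≥ 2`, `H ∈ ℂ[x₀][x₁][y₁]` with some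
`y₁`-coefficient not divisible by `F`; `f, g` the two polynomials rewritten with `x₀` as the
variable over `ℂ[x₁][y₁]` (through their evaluations).  Then there is `D ∈ ℂ[x₁][y₁]`, `D ≠ 0`,
with `F(c, a) = 0 ∧ H(c, a, b) = 0 ⟹ D(a, b) = 0`. [folklore] -/
theorem exists_eliminant₃ (H : Polynomial ℂ[X][X]) (hFirr : Irreducible F) (hF2 : 2 ≤ F.natDegree)
    (hH : ∃ m, ¬ F ∣ H.coeff m) (f g : Polynomial (ℂ[X][X]))
    (hf : ∀ a b c : ℂ, (f.map ((Polynomial.evalRingHom b).comp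
      (Polynomial.mapRingHom (Polynomial.evalRingHom a)))).eval c =
      (F.map (Polynomial.evalRingHom c)).eval a)
    (hg : ∀ a b c : ℂ, (g.map ((Polynomial.evalRingHom b).comp
      (Polynomial.mapRingHom (Polynomial.evalRingHom a)))).eval c =
      (H.map (Polynomial.eval₂RingHom (Polynomial.evalRingHom c) a)).eval b) :
    ∃ D : ℂ[X][X], D ≠ 0 ∧ ∀ a b c : ℂ, (F.map (Polynomial.evalRingHom c)).eval a = 0 →
      (H.map (Polynomial.eval₂RingHom (Polynomial.evalRingHom c) a)).eval b = 0 →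
      (D.map (Polynomial.evalRingHom a)).eval b = 0 := by
  classical
  set φ : ℂ → ℂ → (ℂ[X][X] →+* ℂ) := fun a b =>
    (Polynomial.evalRingHom b).comp (Polynomial.mapRingHom (Polynomial.evalRingHom a)) with hφ
  have hφev : ∀ a b (P : ℂ[X][X]), φ a b P = (P.map (Polynomial.evalRingHom a)).eval b := by
    intro a b P; rfl
  have hF1 : F.natDegree ≠ 0 := by omega
  -- `H(c, a, ·)` as a polynomial in `y₁`: its coefficients are the `h_m(c, a)`
  have hHev : ∀ a c : ℂ, H.map (Polynomial.eval₂RingHom (Polynomial.evalRingHom c) a) =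
      ∑ m ∈ Finset.range (H.natDegree + 1),
        Polynomial.C (((H.coeff m).map (Polynomial.evalRingHom c)).eval a) * Polynomial.X ^ m := by
    intro a c
    have hdeg : (H.map (Polynomial.eval₂RingHom (Polynomial.evalRingHom c) a)).natDegree <
        H.natDegree + 1 := lt_of_le_of_lt Polynomial.natDegree_map_le (Nat.lt_succ_self _)
    rw [(H.map _).as_sum_range_C_mul_X_pow' hdeg]
    refine Finset.sum_congr rfl fun m _ => ?_
    rw [Polynomial.coeff_map, Polynomial.coe_eval₂RingHom, Polynomial.eval₂_eq_eval_map]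
  -- every `F(c, ·)` is a nonzero polynomial
  have hFc : ∀ c : ℂ, F.map (Polynomial.evalRingHom c) ≠ 0 := by
    intro c hc
    obtain ⟨j, hj⟩ := exists_coeff_not_isRoot_of_irreducible hFirr hF1 c
    apply hj
    have h := congrArg (fun q : ℂ[X] => q.coeff j) hc
    simp only [Polynomial.coeff_map, Polynomial.coe_evalRingHom, Polynomial.coeff_zero] at h
    exact h
  -- `f` has positive degree
  set m := f.natDegree with hm
  set n := g.natDegree with hn
  have hm0 : m ≠ 0 := by
    intro hm0
    have hfC := Polynomial.eq_C_of_natDegree_eq_zero hm0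
    obtain ⟨c₀, hc₀⟩ := exists_eval_ne_zero F.leadingCoeff
      (Polynomial.leadingCoeff_ne_zero.2 hFirr.ne_zero)
    obtain ⟨a₀, ha₀⟩ : ∃ a₀ : ℂ, (F.map (Polynomial.evalRingHom c₀)).eval a₀ = 0 := by
      have hnd : (F.map (Polynomial.evalRingHom c₀)).natDegree = F.natDegree :=
        Polynomial.natDegree_map_of_leadingCoeff_ne_zero _ (by rwa [Polynomial.coe_evalRingHom])
      have hdeg : (F.map (Polynomial.evalRingHom c₀)).degree ≠ 0 := by
        rw [Polynomial.degree_eq_natDegree (hFc c₀), hnd]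
        exact_mod_cast hF1
      obtain ⟨y, hy⟩ := IsAlgClosed.exists_root _ hdeg
      exact ⟨y, hy⟩
    have hall : ∀ c : ℂ, (F.map (Polynomial.evalRingHom c)).eval a₀ = 0 := by
      intro c
      rw [← hf a₀ 0 c, hfC, Polynomial.map_C, Polynomial.eval_C]
      have h0 := hf a₀ 0 c₀
      rw [hfC, Polynomial.map_C, Polynomial.eval_C] at h0
      rw [h0, ha₀]
    have := natDegree_eq_one_of_vanish_horizontal hFirr hall
    omega
  -- the eliminant
  set D : ℂ[X][X] := Polynomial.resultant f g m n with hD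
  obtain ⟨p, q, -, -, hpq⟩ := Polynomial.exists_mul_add_mul_eq_C_resultant f g
    (le_refl m) (le_refl n) (Or.inl hm0)
  have hpq' : f * p + g * q = Polynomial.C D := hpq
  refine ⟨D, ?_, ?_⟩
  swap
  · intro a b c hFca hHcb
    have h := congrArg (fun P : Polynomial (ℂ[X][X]) => (P.map (φ a b)).eval c) hpq'
    simp only [Polynomial.map_add, Polynomial.map_mul, Polynomial.eval_add, Polynomial.eval_mul,
      Polynomial.map_C, Polynomial.eval_C] at h
    rw [hf, hg, hFca, hHcb, zero_mul, zero_mul, add_zero] at h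
    rw [← hφev, ← h]
  -- `D ≠ 0`: specialise at a good point `(a, b)`
  intro hD0
  obtain ⟨m₀, hm₀⟩ := hH
  have hf0 : f ≠ 0 := fun h => hm0 (by rw [hm, h, Polynomial.natDegree_zero])
  have hhm₀0 : H.coeff m₀ ≠ 0 := fun h => hm₀ (by rw [h]; exact dvd_zero F)
  have hg0 : g ≠ 0 := by
    intro h0
    -- `h_{m₀} ≠ 0` gives `(c, a)` with `h_{m₀}(c, a) ≠ 0`, hence `b` with `H(c, a, b) ≠ 0`
    obtain ⟨i, hi⟩ : ∃ i, (H.coeff m₀).coeff i ≠ 0 := by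
      by_contra hall; push Not at hall
      exact hhm₀0 (Polynomial.ext fun i => by rw [hall i, Polynomial.coeff_zero])
    obtain ⟨c, hc⟩ := exists_eval_ne_zero _ hi
    have hHc : (H.coeff m₀).map (Polynomial.evalRingHom c) ≠ 0 := by
      intro h1
      have := congrArg (fun q : ℂ[X] => q.coeff i) h1
      simp only [Polynomial.coeff_map, Polynomial.coe_evalRingHom, Polynomial.coeff_zero] at this
      exact hc this
    obtain ⟨a, ha⟩ := exists_eval_ne_zero _ hHc
    have hHca : H.map (Polynomial.eval₂RingHom (Polynomial.evalRingHom c) a) ≠ 0 := by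
      intro h1
      have h2 := congrArg (fun q : ℂ[X] => q.coeff m₀) h1
      simp only [Polynomial.coeff_map, Polynomial.coe_eval₂RingHom, Polynomial.eval₂_eq_eval_map,
        Polynomial.coeff_zero] at h2
      exact ha h2
    obtain ⟨b, hb⟩ := exists_eval_ne_zero _ hHca
    apply hb
    rw [← hg a b c, h0, Polynomial.map_zero, Polynomial.eval_zero]
  have hlcf : f.leadingCoeff ≠ 0 := Polynomial.leadingCoeff_ne_zero.2 hf0
  have hlcg : g.leadingCoeff ≠ 0 := Polynomial.leadingCoeff_ne_zero.2 hg0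
  -- finitely many bad `a`
  set A₁ : Set ℂ := {a | f.leadingCoeff.map (Polynomial.evalRingHom a) = 0} with hA₁
  set A₃ : Set ℂ := {a | g.leadingCoeff.map (Polynomial.evalRingHom a) = 0} with hA₃
  set A₂ : Set ℂ := {a | ∃ c : ℂ, (F.map (Polynomial.evalRingHom c)).eval a = 0 ∧
    ((H.coeff m₀).map (Polynomial.evalRingHom c)).eval a = 0} with hA₂
  have hA₁f : A₁.Finite := finite_setOf_rows_eq_zero _ hlcf
  have hA₃f : A₃.Finite := finite_setOf_rows_eq_zero _ hlcg
  have hA₂f : A₂.Finite := finite_snd_commonZeros F hFirr hm₀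
  obtain ⟨a, ha⟩ := ((hA₁f.union hA₃f).union hA₂f).infinite_compl.nonempty
  simp only [Set.mem_compl_iff, Set.mem_union, not_or] at ha
  obtain ⟨⟨ha₁, ha₃⟩, ha₂⟩ := ha
  -- the specialised `f` does not depend on `b`
  set Fa : ℂ[X] := f.map (φ a 0) with hFa
  have hFab : ∀ b, f.map (φ a b) = Fa := by
    intro b
    refine Polynomial.funext fun c => ?_
    rw [hFa, hf, hf]
  have hFaev : ∀ c, Fa.eval c = (F.map (Polynomial.evalRingHom c)).eval a := fun c => by rw [hFa, hf]
  obtain ⟨b₀, hb₀⟩ := exists_eval_ne_zero _ ha₁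
  have hFam : Fa.coeff m = (f.leadingCoeff.map (Polynomial.evalRingHom a)).eval b₀ := by
    rw [← hFab b₀, Polynomial.coeff_map, ← hφev]; rfl
  have hFam0 : Fa.coeff m ≠ 0 := by rw [hFam]; exact hb₀
  have hFa0 : Fa ≠ 0 := fun h => hFam0 (by rw [h, Polynomial.coeff_zero])
  have hFadeg : Fa.natDegree = m := by
    refine le_antisymm ?_ (Polynomial.le_natDegree_of_ne_zero hFam0)
    rw [hFa]; exact Polynomial.natDegree_map_le
  -- over a root `c` of `Fa`, `H(c, a, ·)` is a nonzero polynomial in `y₁`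
  have hHc : ∀ c, Fa.IsRoot c → H.map (Polynomial.eval₂RingHom (Polynomial.evalRingHom c) a) ≠ 0 := by
    intro c hc hzero
    apply ha₂
    refine ⟨c, by rw [← hFaev]; exact hc, ?_⟩
    have h2 := congrArg (fun q : ℂ[X] => q.coeff m₀) hzero
    simp only [Polynomial.coeff_map, Polynomial.coe_eval₂RingHom, Polynomial.eval₂_eq_eval_map,
      Polynomial.coeff_zero] at h2
    exact h2
  -- finitely many bad `b`
  set B₂ : Set ℂ := {b | (g.leadingCoeff.map (Polynomial.evalRingHom a)).IsRoot b} with hB₂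
  set B₁ : Set ℂ := ⋃ c ∈ {c : ℂ | Fa.IsRoot c},
    {b | (H.map (Polynomial.eval₂RingHom (Polynomial.evalRingHom c) a)).IsRoot b} with hB₁
  have hB₂f : B₂.Finite := Polynomial.finite_setOf_isRoot ha₃
  have hB₁f : B₁.Finite :=
    (Polynomial.finite_setOf_isRoot hFa0).biUnion fun c hc => Polynomial.finite_setOf_isRoot (hHc c hc)
  obtain ⟨b, hb⟩ := (hB₂f.union hB₁f).infinite_compl.nonempty
  simp only [Set.mem_compl_iff, Set.mem_union, not_or] at hb
  obtain ⟨hb₂, hb₁⟩ := hb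
  -- the specialised `g`
  set Gb : ℂ[X] := g.map (φ a b) with hGb
  have hGbn : Gb.coeff n = (g.leadingCoeff.map (Polynomial.evalRingHom a)).eval b := by
    rw [hGb, Polynomial.coeff_map, ← hφev]; rfl
  have hGbn0 : Gb.coeff n ≠ 0 := by rw [hGbn]; exact hb₂
  have hGbdeg : Gb.natDegree = n := by
    refine le_antisymm ?_ (Polynomial.le_natDegree_of_ne_zero hGbn0)
    rw [hGb]; exact Polynomial.natDegree_map_le
  -- no common root
  have hcop : IsCoprime Fa Gb := by
    refine (Polynomial.isCoprime_iff_aeval_ne_zero_of_isAlgClosed ℂ ℂ Fa Gb).2 fun c => ?_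
    by_cases hc : Fa.IsRoot c
    · right
      have hbc : ¬ (H.map (Polynomial.eval₂RingHom (Polynomial.evalRingHom c) a)).IsRoot b := by
        intro hroot
        apply hb₁
        rw [hB₁, Set.mem_iUnion₂]
        exact ⟨c, hc, hroot⟩
      rw [Polynomial.coe_aeval_eq_eval, hGb, hg]
      exact fun h => hbc h
    · left
      rw [Polynomial.coe_aeval_eq_eval]
      exact hc
  have hres : Polynomial.resultant Fa Gb ≠ 0 := by
    intro h
    rw [Polynomial.resultant_eq_zero_iff] at h
    exact h.2 hcop
  apply hres
  have : Polynomial.resultant Fa Gb = Polynomial.resultant Fa Gb m n := by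
    rw [← hFadeg, ← hGbdeg]
  rw [this, ← hFab b, hGb, Polynomial.resultant_map_map]
  change (φ a b) D = 0
  rw [hD0, map_zero]

/-! ## Part C. `H(x₀, x₁, y₁)` with `x₀` as the variable over `ℂ[x₁][y₁]` -/

/-- The re-indexed `H`: `x₀ ↦` the (outer) variable, `x₁ ↦ C (C X)`, `y₁ ↦ C X`; through its
evaluations. [folklore] -/
theorem eval_swap₃ToX0 (H : Polynomial ℂ[X][X]) (a b c : ℂ) :
    ((H.eval₂ (Polynomial.eval₂RingHom
        (Polynomial.eval₂RingHom ((Polynomial.C : ℂ[X][X] →+* Polynomial ℂ[X][X]).comp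
          ((Polynomial.C : ℂ[X] →+* ℂ[X][X]).comp Polynomial.C)) (Polynomial.X : Polynomial ℂ[X][X]))
        (Polynomial.C (Polynomial.C (Polynomial.X : ℂ[X]) : ℂ[X][X])))
        (Polynomial.C (Polynomial.X : ℂ[X][X]))).map
      ((Polynomial.evalRingHom b).comp (Polynomial.mapRingHom (Polynomial.evalRingHom a)))).eval c =
      (H.map (Polynomial.eval₂RingHom (Polynomial.evalRingHom c) a)).eval b := by
  -- both sides are ring homomorphisms in `H` agreeing on the generators
  set ψ : ℂ[X][X] →+* ℂ := (Polynomial.evalRingHom b).comp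
    (Polynomial.mapRingHom (Polynomial.evalRingHom a)) with hψ
  set τ : ℂ[X][X] →+* Polynomial ℂ[X][X] := Polynomial.eval₂RingHom
    (Polynomial.eval₂RingHom ((Polynomial.C : ℂ[X][X] →+* Polynomial ℂ[X][X]).comp
      ((Polynomial.C : ℂ[X] →+* ℂ[X][X]).comp Polynomial.C)) (Polynomial.X : Polynomial ℂ[X][X]))
    (Polynomial.C (Polynomial.C (Polynomial.X : ℂ[X]) : ℂ[X][X])) with hτ
  have hψC : ∀ r : ℂ, ψ (Polynomial.C (Polynomial.C r)) = r := by
    intro r; simp [hψ]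
  have hψX : ψ Polynomial.X = b := by simp [hψ]
  have hψCX : ψ (Polynomial.C Polynomial.X) = a := by simp [hψ]
  -- the inner homomorphism `ℂ[x₀] → ℂ`: `x₀ ↦ c`
  have e₁ : ((Polynomial.eval₂RingHom ψ c).comp
      (Polynomial.eval₂RingHom ((Polynomial.C : ℂ[X][X] →+* Polynomial ℂ[X][X]).comp
        ((Polynomial.C : ℂ[X] →+* ℂ[X][X]).comp Polynomial.C)) (Polynomial.X : Polynomial ℂ[X][X]))) =
      Polynomial.evalRingHom c := by
    refine Polynomial.ringHom_ext (fun r => ?_) ?_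
    · simp only [RingHom.comp_apply, Polynomial.coe_eval₂RingHom, Polynomial.eval₂_C,
        Polynomial.coe_evalRingHom, Polynomial.eval_C, hψC]
    · simp only [RingHom.comp_apply, Polynomial.coe_eval₂RingHom, Polynomial.eval₂_X,
        Polynomial.coe_evalRingHom, Polynomial.eval_X]
  -- the middle homomorphism `ℂ[x₀][x₁] → ℂ`: `x₀ ↦ c`, `x₁ ↦ a`
  have e₂ : (Polynomial.eval₂RingHom ψ c).comp τ =
      Polynomial.eval₂RingHom (Polynomial.evalRingHom c) a := by
    refine Polynomial.ringHom_ext (fun r => ?_) ?_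
    · have h := congrArg (fun f : ℂ[X] →+* ℂ => f r) e₁
      simp only [RingHom.comp_apply] at h
      have hτC : τ (Polynomial.C r) = (Polynomial.eval₂RingHom
          ((Polynomial.C : ℂ[X][X] →+* Polynomial ℂ[X][X]).comp
            ((Polynomial.C : ℂ[X] →+* ℂ[X][X]).comp Polynomial.C))
          (Polynomial.X : Polynomial ℂ[X][X])) r := by
        rw [hτ, Polynomial.coe_eval₂RingHom, Polynomial.eval₂_C]
      rw [RingHom.comp_apply, hτC, h, Polynomial.coe_eval₂RingHom, Polynomial.eval₂_C]
    · have hτX : τ Polynomial.X = Polynomial.C (Polynomial.C Polynomial.X) := by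
        rw [hτ, Polynomial.coe_eval₂RingHom, Polynomial.eval₂_X]
      rw [RingHom.comp_apply, hτX, Polynomial.coe_eval₂RingHom, Polynomial.eval₂_C,
        Polynomial.coe_eval₂RingHom, Polynomial.eval₂_X, hψCX]
  -- the whole thing
  rw [Polynomial.eval_map, ← Polynomial.coe_eval₂RingHom, Polynomial.hom_eval₂, e₂,
    Polynomial.coe_eval₂RingHom, Polynomial.eval₂_C, hψX, Polynomial.eval_map]

/-! ## Part D. Transcendence of `e^{x₁}` over `(x₀, x₁)` along a bounded branch -/

/-- **Along a bounded branch, `e^{x₁}` satisfies no algebraic relation with `(x₀, x₁)`.**  `F`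
irreducible of `x₁`-degree `≥ 2`, a bounded place `F(s^{-k}, Φ(s)) = 0`; `H ∈ ℂ[x₀][x₁][y₁]` with
some `y₁`-coefficient not divisible by `F`.  Then `H(s^{-k}, Φ(s), e^{Φ(s)}) ≢ 0` near `s = 0`.
[folklore] (new in this form) -/
theorem not_eventually_relation₃_exp_boundedBranch (hFirr : Irreducible F) (hn : 2 ≤ F.natDegree)
    {k : ℕ} (hk : 1 ≤ k) {Φ : ℂ → ℂ} (hΦan : AnalyticAt ℂ Φ 0)
    (hplace : ∀ᶠ s in 𝓝[≠] (0 : ℂ), (F.map (Polynomial.evalRingHom (s ^ k)⁻¹)).eval (Φ s) = 0)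
    (H : Polynomial ℂ[X][X]) (hH : ∃ m, ¬ F ∣ H.coeff m) :
    ¬ ∀ᶠ u in 𝓝[≠] (0 : ℂ),
      (H.map (Polynomial.eval₂RingHom (Polynomial.evalRingHom (u ^ k)⁻¹) (Φ u))).eval
        (Complex.exp (Φ u)) = 0 := by
  classical
  intro hrel
  obtain ⟨D, hD0, hDvan⟩ := exists_eliminant₃ F H hFirr hn hH _ _ (eval_swapToX1 F) (eval_swap₃ToX0 H)
  -- `D(Φ u, e^{Φ u}) = 0` near `0`
  set gD : ℂ → ℂ := fun z => ∑ j ∈ Finset.range (D.natDegree + 1),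
    (D.coeff j).eval z * Complex.exp z ^ j with hgD
  have hgDev : ∀ z, gD z = (D.map (Polynomial.evalRingHom z)).eval (Complex.exp z) := by
    intro z; rw [hgD, evalPP_eq_sum D z _ (Nat.lt_succ_self _)]
  have hgDan : AnalyticOnNhd ℂ gD Set.univ := by
    intro z _
    rw [hgD]
    refine Finset.analyticAt_fun_sum _ fun j _ => ?_
    exact (analyticAt_polynomial_eval_comp analyticAt_id _).mul (analyticAt_cexp.pow j)
  have hrelD : ∀ᶠ u in 𝓝[≠] (0 : ℂ), gD (Φ u) = 0 := by
    filter_upwards [hplace, hrel] with u hF hHu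
    rw [hgDev]
    exact hDvan (Φ u) (Complex.exp (Φ u)) ((u ^ k)⁻¹) hF hHu
  -- the branch is not horizontal
  set θ : ℂ := Φ 0 with hθ
  have hΦne : ∀ᶠ u in 𝓝[≠] (0 : ℂ), Φ u ≠ θ := by
    rcases (hΦan.sub (analyticAt_const : AnalyticAt ℂ (fun _ : ℂ => θ) 0)).eventually_eq_zero_or_eventually_ne_zero
      with h | h
    · exfalso
      have hG : (Polynomial.X - Polynomial.C (Polynomial.C θ) : ℂ[X][X]) = 0 := by
        refine rows_eq_zero_of_eventually_zero_along_place' F hFirr (by omega) _ ?_ hk hplace ?_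
        · rw [Polynomial.natDegree_X_sub_C]; omega
        · filter_upwards [eventually_nhdsWithin_of_eventually_nhds h] with u hu
          simp only [Pi.sub_apply, sub_eq_zero] at hu
          simp [hu]
      exact Polynomial.X_sub_C_ne_zero _ hG
    · filter_upwards [h] with u hu
      simpa [sub_eq_zero] using hu
  have hΦtend : Tendsto Φ (𝓝[≠] (0 : ℂ)) (𝓝[≠] θ) :=
    tendsto_nhdsWithin_iff.2 ⟨(hΦan.continuousAt.tendsto).mono_left nhdsWithin_le_nhds, hΦne⟩
  have hfreq : ∃ᶠ z in 𝓝[≠] θ, gD z = 0 := hΦtend.frequently hrelD.frequently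
  have hzero := hgDan.eqOn_zero_of_preconnected_of_frequently_eq_zero isPreconnected_univ
    (Set.mem_univ θ) hfreq
  obtain ⟨z, hz⟩ := exists_exp_relation_ne_zero D hD0
  apply hz
  rw [← hgDev]
  exact hzero (Set.mem_univ z)

end EliminantThree

end Summit.Schanuel.Schanuel.Theorems
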